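import Summits.AtomisticToContinuum.FouriersLaw.Theorems.LocalOhmBVLocalOhmStubNoUnitCurrentOfZeroDrudeVarAux1
import Literature.MathematicalPhysics.KineticTheory.InfiniteChainDLRUniqueness

/-!
# T♯4 `stub_noUnitCurrent_of_zeroDrudeVar`: no unit-current `√n`-regular invariant functional under VZD
(crux `LocalOhmBV.LocalOhm`, item stmt-AtomisticToContinuum-12009, line `registered`/birth, skeleton v9; the
classical bridge from the variational zero-Drude hypothesis VZD to the rigidity used by `LocalOhm_of`)

For `P = pinnedChain ω₂ lam β γ` (all parameters `> 0`), `T > 0` and a shift-invariant Gibbs state `μ` of the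
infinite chain satisfying the block-sum conclusion of VZD (`stub_zeroDrudeVar`), NO functional `Λ` on observables
of `ChainConfig` is simultaneously (1) linear on continuous polynomially bounded cylinder pairs, (2♯) `√n`-regular,
(3) `liouvilleZ`-invariant on `C¹` polynomially bounded cylinder functions and (4) of unit current on every bond.

Proof. With the data `a, n, G, E` of VZD at a suitable `ε` and `f_x = j_x − 𝒜(G ∘ box_{a+x,n}) − E ∘ box_{a+x,n}`,
all of `j_x`, `𝒜(G ∘ box_{a+x,n})`, `E ∘ box_{a+x,n}` (`x ≤ M`) are continuous polynomially bounded window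
functions on ONE box of `K + 1 ≤ 2(M+1)` sites (`exists_bigWindow`, `exists_liouvilleWindow` of the helper file
`…StubNoUnitCurrentOfZeroDrudeVarAux1`), so by (1),
(3), (4) `Λ(Σ_{x≤M} f_x) = Σ_{x≤M} (1 − 0 − Λ(E_x))`, while the momentum-reversed block sum
`(Σ f_x) ∘ R = Σ_{x≤M} (−j_x + 𝒜((G ∘ rev) ∘ box) − E_x)` (`bondCurrentZ_momentumReversalZ`,
`liouvilleZ_comp_momentumReversalZ`, `E` even) has `Λ`-value `Σ_{x≤M} (−1 + 0 − Λ(E_x))`: the difference is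
`2(M+1)`. By (2♯) and `μ ∘ R⁻¹ = μ` (`IsChainGibbsMeasure.map_momentumReversalZ` + uniqueness of the
shift-invariant Gibbs state) both values are `≤ |A| √(K+1) (ε (M+1))^{1/2}` in absolute value, which for
`M` large and `2 A² ε < 1` is `< M + 1`. No definitions.
-/

set_option autoImplicit false

noncomputable section

namespace Summit.AtomisticToContinuum.FouriersLaw.Theorems.LocalOhmBirth

open MeasureTheory Filter Topology
open scoped BigOperators
open Literature.MathematicalPhysics.KineticTheory
open Literature.MathematicalPhysics.KineticTheory.HeatConduction

/-! ## The bridge -/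

/-- **T♯4 `stub_noUnitCurrent_of_zeroDrudeVar`** (classical bridge of the birth line of `LocalOhmBV.LocalOhm`).
For `P = pinnedChain ω₂ lam β γ` (all parameters `> 0`), `T > 0` and a shift-invariant Gibbs state `μinf`
satisfying the conclusion of VZD (`stub_zeroDrudeVar`: for every `ε > 0` some translates
`f_x = j_x − 𝒜(G ∘ box_{a+x,n}) − E ∘ box_{a+x,n}`, `G` of class `C¹` polynomially bounded with its derivative,
`E` continuous polynomially bounded and momentum-even, have `∫ (Σ_{x≤M} f_x)² dμinf ≤ ε (M+1)` for arbitrarily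
large `M`), NO functional `Λ` is at the same time (1) linear on continuous polynomially bounded cylinder pairs,
(2♯) `√n`-regular, (3) `liouvilleZ`-invariant on `C¹` polynomially bounded cylinder functions and (4) of unit
current on every bond. Proof: all of `j_x`, `𝒜(G ∘ box_{a+x,n})`, `E ∘ box_{a+x,n}` (`x ≤ M`) are continuous
polynomially bounded window functions on one box of `K + 1 ≤ 2(M+1)` sites, so `Λ(Σ_{x≤M} f_x) = Σ (1 − 0 − Λ E_x)`
by (1), (3), (4); the momentum-reversed block sum `Σ_{x≤M} (−j_x + 𝒜((G ∘ rev) ∘ box) − E_x)` (pointwise equal to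
`(Σ f_x) ∘ R`: `j_x` odd, `𝒜(f ∘ R) = −(𝒜f) ∘ R`, `E` even) has `Λ`-value `Σ (−1 + 0 − Λ E_x)`; the difference
`2(M+1)` is by (2♯) and `μinf ∘ R⁻¹ = μinf` (reversed Gibbs state + uniqueness of the shift-invariant Gibbs state)
at most `2|A| √(K+1) (ε(M+1))^{1/2} ≤ 2|A| (2ε)^{1/2} (M+1) < 2(M+1)` once `2A²ε < 1`. [folklore] -/
theorem stub_noUnitCurrent_of_zeroDrudeVar :
    ∀ ω₂ lam β γ : ℝ, 0 < ω₂ → 0 < lam → 0 < β → 0 < γ → ∀ T : ℝ, 0 < T →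
    ∀ μinf : Measure ChainConfig, (pinnedChain ω₂ lam β γ).IsChainGibbsMeasure T μinf →
    IsShiftInvariant μinf →
    (∀ ε : ℝ, 0 < ε → ∃ (a : ℤ) (n : ℕ) (G E : (Fin (n + 1) → ℝ × ℝ) → ℝ),
      ContDiff ℝ 1 G ∧
      (∃ (C₀ : ℝ) (m : ℕ), ∀ y, |G y| ≤ C₀ * (1 + ‖y‖) ^ m ∧ ‖fderiv ℝ G y‖ ≤ C₀ * (1 + ‖y‖) ^ m) ∧
      Continuous E ∧ (∃ (C₀ : ℝ) (m : ℕ), ∀ y, |E y| ≤ C₀ * (1 + ‖y‖) ^ m) ∧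
      (∀ y, E (fun i => ((y i).1, -(y i).2)) = E y) ∧
      ∀ M₀ : ℕ, ∃ M : ℕ, M₀ ≤ M ∧
        (∫ σ, (∑ x ∈ Finset.range (M + 1),
            ((pinnedChain ω₂ lam β γ).bondCurrentZ σ (x : ℤ) -
              liouvilleZ (pinnedChain ω₂ lam β γ) (G ∘ boxRestrictAt (a + (x : ℤ)) n) σ -
              E (boxRestrictAt (a + (x : ℤ)) n σ))) ^ 2 ∂μinf) ≤ ε * ((M : ℝ) + 1)) →
    ∀ Λ : (ChainConfig → ℝ) → ℝ,
    (∀ (a : ℤ) (n : ℕ) (c₁ c₂ : ℝ) (g₁ g₂ : (Fin (n + 1) → ℝ × ℝ) → ℝ), Continuous g₁ → Continuous g₂ →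
        (∃ (C₀ : ℝ) (m : ℕ), ∀ y, |g₁ y| ≤ C₀ * (1 + ‖y‖) ^ m ∧ |g₂ y| ≤ C₀ * (1 + ‖y‖) ^ m) →
        Λ ((fun y => c₁ * g₁ y + c₂ * g₂ y) ∘ boxRestrictAt a n) =
          c₁ * Λ (g₁ ∘ boxRestrictAt a n) + c₂ * Λ (g₂ ∘ boxRestrictAt a n)) →
    (∃ A : ℝ, ∀ (n : ℕ) (a : ℤ) (g : (Fin (n + 1) → ℝ × ℝ) → ℝ), Continuous g →
        (∃ (C₀ : ℝ) (m : ℕ), ∀ y, |g y| ≤ C₀ * (1 + ‖y‖) ^ m) →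
        |Λ (g ∘ boxRestrictAt a n)| ≤
          A * Real.sqrt ((n : ℝ) + 1) * Real.sqrt (∫ σ, (g (boxRestrictAt a n σ)) ^ 2 ∂μinf)) →
    (∀ (a : ℤ) (n : ℕ) (G : (Fin (n + 1) → ℝ × ℝ) → ℝ), ContDiff ℝ 1 G →
        (∃ (C₀ : ℝ) (m : ℕ), ∀ y, |G y| ≤ C₀ * (1 + ‖y‖) ^ m ∧ ‖fderiv ℝ G y‖ ≤ C₀ * (1 + ‖y‖) ^ m) →
        Λ (liouvilleZ (pinnedChain ω₂ lam β γ) (G ∘ boxRestrictAt a n)) = 0) →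
    (∀ i : ℤ, Λ (fun σ => (pinnedChain ω₂ lam β γ).bondCurrentZ σ i) = 1) → False := by
  intro ω₂ lam β γ hω hl hβ _hγ T hT μinf hGibbs hS hVZD Λ hlin hbd hinv hcur
  -- Step 0: the regularity constant made non-negative, and `R`-invariance of `μinf`
  obtain ⟨A, hA⟩ := hbd
  obtain ⟨B, hBdef⟩ : ∃ B : ℝ, B = |A| := ⟨_, rfl⟩
  have hB0 : 0 ≤ B := hBdef ▸ abs_nonneg A
  have hreg : ∀ (n : ℕ) (a : ℤ) (g : (Fin (n + 1) → ℝ × ℝ) → ℝ), Continuous g →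
      (∃ (C₀ : ℝ) (m : ℕ), ∀ y, |g y| ≤ C₀ * (1 + ‖y‖) ^ m) →
      |Λ (g ∘ boxRestrictAt a n)| ≤
        B * Real.sqrt ((n : ℝ) + 1) * Real.sqrt (∫ σ, (g (boxRestrictAt a n σ)) ^ 2 ∂μinf) := by
    intro n a g hg hb
    refine (hA n a g hg hb).trans ?_
    have h1 : A ≤ B := hBdef ▸ le_abs_self A
    exact mul_le_mul_of_nonneg_right (mul_le_mul_of_nonneg_right h1 (Real.sqrt_nonneg _))
      (Real.sqrt_nonneg _)
  have hRμ : μinf.map momentumReversalZ = μinf :=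
    OscillatorChain.pinnedChain_eq_of_isChainGibbsMeasure_of_isShiftInvariant γ hω hl.le hβ.le hT
      hGibbs.map_momentumReversalZ hS.map_momentumReversalZ hGibbs hS
  -- Step 1: `ε` with `2 B² ε < 1`, the data of VZD at `ε`, a large `M`, the common box `{A₀, …, A₀ + K}`
  obtain ⟨ε, hεdef⟩ : ∃ ε : ℝ, ε = 1 / (2 * B ^ 2 + 1) := ⟨_, rfl⟩
  have hε : 0 < ε := by rw [hεdef]; positivity
  have hεB : 2 * B ^ 2 * ε < 1 := by
    rw [hεdef, mul_one_div, div_lt_one (by positivity)]; linarith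
  obtain ⟨a, n, G, E, hGd, ⟨C_G, m_G, hCG⟩, hEc, ⟨C_E, m_E, hCE⟩, hEeven, hM⟩ := hVZD ε hε
  obtain ⟨M, hM₀, hint⟩ := hM (n + 2 * a.natAbs + 2)
  obtain ⟨A₀, hA₀⟩ : ∃ A₀ : ℤ, A₀ = -(a.natAbs : ℤ) - 1 := ⟨_, rfl⟩
  obtain ⟨K, hK⟩ : ∃ K : ℕ, K = M + n + 2 * a.natAbs + 2 := ⟨_, rfl⟩
  have hK2 : (K : ℝ) + 1 ≤ 2 * ((M : ℝ) + 1) := by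
    have : K + 1 ≤ 2 * (M + 1) := by omega
    exact_mod_cast this
  -- Step 2: the window functions of `j_x`, `𝒜(G ∘ box_{a+x,n})`, `𝒜((G ∘ rev) ∘ box_{a+x,n})`, `E ∘ box_{a+x,n}`
  have hCG0 : 0 ≤ C_G := by
    have h := (abs_nonneg _).trans (hCG 0).1
    simpa using h
  have hCE0 : 0 ≤ C_E := by
    have h := (abs_nonneg _).trans (hCE 0)
    simpa using h
  obtain ⟨jw, hjwc, hjwb, hjwbox⟩ := exists_bondCurrentWindow ω₂ lam β γ
  obtain ⟨gL, hgLc, hgLb, hgLbox⟩ := exists_liouvilleWindow ω₂ lam β γ n G hGd C_G m_G fun y => (hCG y).2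
  have hGr : ContDiff ℝ 1 (fun y : Fin (n + 1) → ℝ × ℝ => G (fun j => ((y j).1, -(y j).2))) :=
    contDiff_comp_boxRev hGd
  have hCGr : ∀ y : Fin (n + 1) → ℝ × ℝ, |G (fun j => ((y j).1, -(y j).2))| ≤ C_G * (1 + ‖y‖) ^ m_G ∧
      ‖fderiv ℝ (fun y : Fin (n + 1) → ℝ × ℝ => G (fun j => ((y j).1, -(y j).2))) y‖ ≤
        C_G * (1 + ‖y‖) ^ m_G := fun y =>
    ⟨polyBound_comp_boxRev (fun y => (hCG y).1) y, norm_fderiv_comp_boxRev_le hGd (fun y => (hCG y).2) y⟩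
  obtain ⟨gLr, hgLrc, hgLrb, hgLrbox⟩ := exists_liouvilleWindow ω₂ lam β γ n _ hGr C_G m_G fun y => (hCGr y).2
  obtain ⟨CL, hCLdef⟩ : ∃ CL : ℝ, CL = ((n : ℝ) + 1) * (C_G * (1 + 3 * (|ω₂| + |lam| + 4 + 8 * |β|))) :=
    ⟨_, rfl⟩
  have hCL0 : 0 ≤ CL := by rw [hCLdef]; positivity
  rw [← hCLdef] at hgLb hgLrb
  obtain ⟨CC, hCCdef⟩ : ∃ CC : ℝ, CC = (2 + 8 * |β|) + CL + C_E := ⟨_, rfl⟩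
  have hCC0 : 0 ≤ CC := by rw [hCCdef]; positivity
  obtain ⟨mm, hmmdef⟩ : ∃ mm : ℕ, mm = 4 + (m_G + 3) + m_E := ⟨_, rfl⟩
  -- the four families on the common box
  have hJex : ∀ i : Fin (M + 1), ∃ w : (Fin (K + 1) → ℝ × ℝ) → ℝ, Continuous w ∧
      (∀ y, |w y| ≤ CC * (1 + ‖y‖) ^ mm) ∧
      w ∘ boxRestrictAt A₀ K = fun σ => (pinnedChain ω₂ lam β γ).bondCurrentZ σ ((i : ℕ) : ℤ) := by
    intro i
    have hi := i.isLt
    obtain ⟨w, hwc, hwb, hwbox⟩ := exists_bigWindow (A₀ := A₀) (a' := ((i : ℕ) : ℤ)) (K := K) (n' := 1)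
      (C₀ := CC) (m := mm) (by omega) (by omega) hjwc hCC0
      (fun y => polyBound_weaken (by positivity) (by rw [hCCdef]; linarith) (by omega) (norm_nonneg y)
        (hjwb y))
    exact ⟨w, hwc, hwb, hwbox.trans (hjwbox _)⟩
  choose J hJc hJb hJbox using hJex
  have hLex : ∀ i : Fin (M + 1), ∃ w : (Fin (K + 1) → ℝ × ℝ) → ℝ, Continuous w ∧
      (∀ y, |w y| ≤ CC * (1 + ‖y‖) ^ mm) ∧
      w ∘ boxRestrictAt A₀ K =
        liouvilleZ (pinnedChain ω₂ lam β γ) (G ∘ boxRestrictAt (a + ((i : ℕ) : ℤ)) n) := by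
    intro i
    have hi := i.isLt
    obtain ⟨w, hwc, hwb, hwbox⟩ := exists_bigWindow (A₀ := A₀) (a' := a + ((i : ℕ) : ℤ) - 1) (K := K)
      (n' := n + 2) (C₀ := CC) (m := mm) (by omega) (by push_cast; omega) hgLc hCC0
      (fun y => polyBound_weaken hCL0 (by rw [hCCdef]; linarith [abs_nonneg β]) (by omega)
        (norm_nonneg y) (hgLb y))
    exact ⟨w, hwc, hwb, hwbox.trans (hgLbox _)⟩
  choose L hLc hLb hLbox using hLex
  have hLrex : ∀ i : Fin (M + 1), ∃ w : (Fin (K + 1) → ℝ × ℝ) → ℝ, Continuous w ∧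
      (∀ y, |w y| ≤ CC * (1 + ‖y‖) ^ mm) ∧
      w ∘ boxRestrictAt A₀ K =
        liouvilleZ (pinnedChain ω₂ lam β γ)
          ((fun y : Fin (n + 1) → ℝ × ℝ => G (fun j => ((y j).1, -(y j).2))) ∘
            boxRestrictAt (a + ((i : ℕ) : ℤ)) n) := by
    intro i
    have hi := i.isLt
    obtain ⟨w, hwc, hwb, hwbox⟩ := exists_bigWindow (A₀ := A₀) (a' := a + ((i : ℕ) : ℤ) - 1) (K := K)
      (n' := n + 2) (C₀ := CC) (m := mm) (by omega) (by push_cast; omega) hgLrc hCC0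
      (fun y => polyBound_weaken hCL0 (by rw [hCCdef]; linarith [abs_nonneg β]) (by omega)
        (norm_nonneg y) (hgLrb y))
    exact ⟨w, hwc, hwb, hwbox.trans (hgLrbox _)⟩
  choose Lr hLrc hLrb hLrbox using hLrex
  have hEex : ∀ i : Fin (M + 1), ∃ w : (Fin (K + 1) → ℝ × ℝ) → ℝ, Continuous w ∧
      (∀ y, |w y| ≤ CC * (1 + ‖y‖) ^ mm) ∧
      w ∘ boxRestrictAt A₀ K = E ∘ boxRestrictAt (a + ((i : ℕ) : ℤ)) n := by
    intro i
    have hi := i.isLt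
    exact exists_bigWindow (A₀ := A₀) (a' := a + ((i : ℕ) : ℤ)) (K := K) (n' := n) (by omega)
      (by omega) hEc hCC0
      (fun y => polyBound_weaken hCE0 (by rw [hCCdef]; linarith [abs_nonneg β]) (by omega)
        (norm_nonneg y) (hCE y))
  choose Ew hEwc hEwb hEwbox using hEex
  -- their `Λ`-values, by (4) and (3)
  have hJv : ∀ i, Λ (J i ∘ boxRestrictAt A₀ K) = 1 := fun i => by
    rw [hJbox i]; exact hcur _
  have hLv : ∀ i, Λ (L i ∘ boxRestrictAt A₀ K) = 0 := fun i => by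
    rw [hLbox i]; exact hinv _ _ G hGd ⟨C_G, m_G, hCG⟩
  have hLrv : ∀ i, Λ (Lr i ∘ boxRestrictAt A₀ K) = 0 := fun i => by
    rw [hLrbox i]; exact hinv _ _ _ hGr ⟨C_G, m_G, hCGr⟩
  -- the block window `F` (the integrand of VZD) and its momentum reversal `Fr`
  obtain ⟨F, hF⟩ : ∃ F : (Fin (K + 1) → ℝ × ℝ) → ℝ,
      ∀ y, F y = ∑ i, ((1 : ℝ) * J i y + (-1) * L i y + (-1) * Ew i y) := ⟨_, fun y => rfl⟩
  obtain ⟨Fr, hFr⟩ : ∃ Fr : (Fin (K + 1) → ℝ × ℝ) → ℝ,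
      ∀ y, Fr y = ∑ i, ((-1 : ℝ) * J i y + 1 * Lr i y + (-1) * Ew i y) := ⟨_, fun y => rfl⟩
  obtain ⟨hFc, hFb, hΛF⟩ := blockWindow_spec Λ hlin A₀ K 1 (-1) (-1) J L Ew F hF hJc hLc hEwc hCC0
    hJb hLb hEwb hJv hLv
  obtain ⟨hFrc, hFrb, hΛFr⟩ := blockWindow_spec Λ hlin A₀ K (-1) 1 (-1) J Lr Ew Fr hFr hJc hLrc hEwc
    hCC0 hJb hLrb hEwb hJv hLrv
  have hdiff : Λ (F ∘ boxRestrictAt A₀ K) - Λ (Fr ∘ boxRestrictAt A₀ K) = 2 * ((M : ℝ) + 1) := by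
    rw [hΛF, hΛFr, ← Finset.sum_sub_distrib]
    have h2 : ∀ i : Fin (M + 1), ((1 : ℝ) + (-1) * Λ (Ew i ∘ boxRestrictAt A₀ K)) -
        (-1 + (-1) * Λ (Ew i ∘ boxRestrictAt A₀ K)) = 2 := fun i => by ring
    simp only [h2]
    rw [Finset.sum_const, Finset.card_univ, Fintype.card_fin, nsmul_eq_mul]
    push_cast
    ring
  -- `F ∘ box` is the integrand of VZD, `Fr ∘ box = (F ∘ box) ∘ R` pointwise
  have hFvzd : ∀ σ, F (boxRestrictAt A₀ K σ) = ∑ x ∈ Finset.range (M + 1),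
      ((pinnedChain ω₂ lam β γ).bondCurrentZ σ (x : ℤ) -
        liouvilleZ (pinnedChain ω₂ lam β γ) (G ∘ boxRestrictAt (a + (x : ℤ)) n) σ -
        E (boxRestrictAt (a + (x : ℤ)) n σ)) := by
    intro σ
    rw [hF, Finset.sum_range]
    refine Finset.sum_congr rfl fun i _ => ?_
    have h1 := congrFun (hJbox i) σ
    have h2 := congrFun (hLbox i) σ
    have h3 := congrFun (hEwbox i) σ
    simp only [Function.comp_apply] at h1 h2 h3
    rw [h1, h2, h3]
    ring
  have hFrR : ∀ σ, Fr (boxRestrictAt A₀ K σ) = F (boxRestrictAt A₀ K (momentumReversalZ σ)) := by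
    intro σ
    rw [hFr, hF]
    refine Finset.sum_congr rfl fun i _ => ?_
    have hJ1 := congrFun (hJbox i) σ
    have hJ2 := congrFun (hJbox i) (momentumReversalZ σ)
    have hL2 := congrFun (hLbox i) (momentumReversalZ σ)
    have hLr1 := congrFun (hLrbox i) σ
    have hE1 := congrFun (hEwbox i) σ
    have hE2 := congrFun (hEwbox i) (momentumReversalZ σ)
    simp only [Function.comp_apply] at hJ1 hJ2 hL2 hLr1 hE1 hE2
    rw [hJ1, hJ2, hL2, hLr1, hE1, hE2, bondCurrentZ_momentumReversalZ,
      ← comp_boxRestrictAt_comp_momentumReversalZ (a + ((i : ℕ) : ℤ)) n G,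
      liouvilleZ_comp_momentumReversalZ, boxRestrictAt_momentumReversalZ_eq, hEeven]
    ring
  -- Step 3: the `L²` sizes and the contradiction
  have hI : ∫ σ, (F (boxRestrictAt A₀ K σ)) ^ 2 ∂μinf ≤ ε * ((M : ℝ) + 1) := by
    have h := hint
    simp_rw [← hFvzd] at h
    exact h
  have hIr : ∫ σ, (Fr (boxRestrictAt A₀ K σ)) ^ 2 ∂μinf = ∫ σ, (F (boxRestrictAt A₀ K σ)) ^ 2 ∂μinf := by
    have h := integral_map_equiv momentumReversalZ (fun σ => (F (boxRestrictAt A₀ K σ)) ^ 2) (μ := μinf)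
    rw [hRμ] at h
    rw [h]
    simp_rw [hFrR]
  have h1 := hreg K A₀ F hFc ⟨_, _, hFb⟩
  have h2 := hreg K A₀ Fr hFrc ⟨_, _, hFrb⟩
  rw [hIr] at h2
  obtain ⟨I, hIdef⟩ : ∃ I : ℝ, I = ∫ σ, (F (boxRestrictAt A₀ K σ)) ^ 2 ∂μinf := ⟨_, rfl⟩
  rw [← hIdef] at h1 h2 hI
  have hM1 : (0 : ℝ) < (M : ℝ) + 1 := by positivity
  have hle : (M : ℝ) + 1 ≤ B * Real.sqrt ((K : ℝ) + 1) * Real.sqrt I := by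
    have e1 := le_abs_self (Λ (F ∘ boxRestrictAt A₀ K) - Λ (Fr ∘ boxRestrictAt A₀ K))
    have e2 := abs_sub (Λ (F ∘ boxRestrictAt A₀ K)) (Λ (Fr ∘ boxRestrictAt A₀ K))
    linarith
  have hst : (M : ℝ) + 1 ≤ B * Real.sqrt (2 * ((M : ℝ) + 1)) * Real.sqrt (ε * ((M : ℝ) + 1)) := by
    calc (M : ℝ) + 1 ≤ B * Real.sqrt ((K : ℝ) + 1) * Real.sqrt I := hle
      _ ≤ B * Real.sqrt (2 * ((M : ℝ) + 1)) * Real.sqrt (ε * ((M : ℝ) + 1)) :=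
          mul_le_mul (mul_le_mul_of_nonneg_left (Real.sqrt_le_sqrt hK2) hB0) (Real.sqrt_le_sqrt hI)
            (Real.sqrt_nonneg _) (by positivity)
  have hsq1 : Real.sqrt (2 * ((M : ℝ) + 1)) ^ 2 = 2 * ((M : ℝ) + 1) := Real.sq_sqrt (by positivity)
  have hsq2 : Real.sqrt (ε * ((M : ℝ) + 1)) ^ 2 = ε * ((M : ℝ) + 1) := Real.sq_sqrt (by positivity)
  have hsq : ((M : ℝ) + 1) ^ 2 ≤ 2 * B ^ 2 * ε * ((M : ℝ) + 1) ^ 2 := by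
    calc ((M : ℝ) + 1) ^ 2
        ≤ (B * Real.sqrt (2 * ((M : ℝ) + 1)) * Real.sqrt (ε * ((M : ℝ) + 1))) ^ 2 :=
          pow_le_pow_left₀ hM1.le hst 2
      _ = B ^ 2 * Real.sqrt (2 * ((M : ℝ) + 1)) ^ 2 * Real.sqrt (ε * ((M : ℝ) + 1)) ^ 2 := by ring
      _ = 2 * B ^ 2 * ε * ((M : ℝ) + 1) ^ 2 := by rw [hsq1, hsq2]; ring
  have hone : (1 : ℝ) ≤ 2 * B ^ 2 * ε := by
    have h' : ((M : ℝ) + 1) ^ 2 * 1 ≤ ((M : ℝ) + 1) ^ 2 * (2 * B ^ 2 * ε) := by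
      calc ((M : ℝ) + 1) ^ 2 * 1 = ((M : ℝ) + 1) ^ 2 := mul_one _
        _ ≤ 2 * B ^ 2 * ε * ((M : ℝ) + 1) ^ 2 := hsq
        _ = ((M : ℝ) + 1) ^ 2 * (2 * B ^ 2 * ε) := by ring
    exact le_of_mul_le_mul_left h' (by positivity)
  linarith

end Summit.AtomisticToContinuum.FouriersLaw.Theorems.LocalOhmBirth

end
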